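import Literature.Barriers.RiemannHypothesis.TuranPartialSumsShiftEM
import Literature.Barriers.RiemannHypothesis.TuranPartialSumsShiftAbel
import Mathlib.NumberTheory.Harmonic.Bounds
import Mathlib.MeasureTheory.Function.JacobianOneDim
import HarnessLib

/-!
# Sections of `ζ` beyond `σ = 1`: block values, step integrands and the sum-to-integral passage

Barrier catalogue `Literature/Barriers/RiemannHypothesis/`, companion of `TuranPartialSums.lean`
(fourth layer of the "vertical shift" proof of `TuranPartialSums` for large `N`; it turns the two
integer sums produced by the prime-sum layer `TuranPartialSumsShiftAbel.lean`,
`∑_{M<n≤N} h(n) S(N/n)` with `S = powSum s`, `s = 1 + iτ`, into integrals of step functions that a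
verified numerical checker can enclose). Everything is PROVED and elementary.

## Contents (namespace `Literature.Barriers.RiemannHypothesis.TuranShift`)

* Pointwise facts on the block values `S(N/k)`, `k = ⌈t⌉` or `⌊t⌋`: `norm_powSum_le_one_add_log`
  (`‖S(m)‖ ≤ 1 + log m`), `norm_powSum_sub_powInt_sub_emConst_le`
  (`‖S(m) − ∫_1^q − c₀‖ ≤ |log(q/m)| + 1/(2m) + ‖s(s+1)‖/(16m²)`), and the index bounds
  `div_ceil_bounds`, `div_floor_bounds` (`m = N/⌈t⌉` or `N/⌊t⌋` satisfies `m ≤ N/t' `,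
  `N/t'' < m + 1` for the obvious `t', t'' ∈ {t − 1, t, t + 1}`).
* The two kernels `hB τ t = t^{-s}/log t`, `hR t = 1/(t log t)` with their derivative majorants
  `DB`, `DR` (`hasDerivAt_hB`, `norm_deriv_hB_le`, `DB_antitoneOn`, `integral_DB_le`, …).
* `stepC G N t = G(N/⌈t⌉)`, `stepF G N t = G(N/⌊t⌋)` (used with `G = S` and `G = ‖S‖`) and
  **`norm_sum_sub_integral_stepC_le`**:
  `‖∑_{M<n≤b} h(n) G(N/n) − ∫_M^b h·stepC‖ ≤ (Gb/2) ∑_{M<n≤b} D(n−1)` for `‖h'‖ ≤ D` antitone and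
  `‖G(N/n)‖ ≤ Gb`; `sum_D_le` (`∑_{M<n≤b} D(n−1) ≤ D(M) + ∫_M^b D`).
* `intervalIntegrable_mul_stepC` / `_stepF` — integrability of the step integrands.
* `sum_mul_le_integral_of_le`, `norm_sub_le_integral`, `norm_sub_mul_le`,
  `norm_sub_mul_le_integral_stepF` — the smooth part of the variation of `h(n) G(N/n)` against
  `∫ D · ‖stepF‖`.
* `div_le_div_succ_add_one`, `eq_div_div_of_jump`, `sum_jumps_le`, `norm_powSum_div_sub_le` — the
  jump part: beyond `√N` the block index drops by at most one at a time, only at the top `n = N/m`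
  of each block, so that `∑_{jumps} F(n) ≤ ∑_{m ≥ 2} F(N/m)`.
* `integral_comp_exp_mul`, `intervalIntegrable_comp_exp_mul` — the substitution `t = e^{uL}`
  (Mathlib's `integral_Icc_deriv_smul_of_deriv_nonneg`), which normalises all integrals to
  `u = log t/log N ∈ [½, 1]` for the checker.

## References

* Standard real analysis (comparison of a sum with an integral). [folklore]
-/

noncomputable section

open Real Complex Set MeasureTheory intervalIntegral Finset Filter Topology

namespace Literature.Barriers.RiemannHypothesis

namespace TuranShift

/-! ## Pointwise facts on the block values -/

/-- `‖S(m)‖ ≤ 1 + log m` for `Re s = 1` (harmonic bound; trivial for `m = 0`). [folklore] -/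
theorem norm_powSum_le_one_add_log {s : ℂ} (hs : s.re = 1) (m : ℕ) :
    ‖powSum s m‖ ≤ 1 + Real.log m := by
  refine (norm_powSum_le hs m).trans ?_
  have h := harmonic_le_one_add_log m
  rw [harmonic_eq_sum_Icc] at h
  push_cast at h
  exact h

/-- The crude bound `‖S(m)‖ ≤ m` (each of the `m` terms has modulus `≤ 1`). [folklore] -/
theorem norm_powSum_le_self {s : ℂ} (hs : s.re = 1) (m : ℕ) :
    ‖powSum s m‖ ≤ m := by
  refine (norm_powSum_le hs m).trans ?_
  calc ∑ k ∈ Finset.Icc 1 m, ((k : ℝ))⁻¹ ≤ ∑ k ∈ Finset.Icc 1 m, (1 : ℝ) := by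
        refine Finset.sum_le_sum fun k hk ↦ ?_
        have hk1 : (1 : ℝ) ≤ k := by exact_mod_cast (Finset.mem_Icc.1 hk).1
        exact inv_le_one_of_one_le₀ hk1
    _ = m := by simp

/-- **The continuous approximation of a block value.** For `Re s = 1`, `s ≠ 1`, `m ≥ 1` and a real
`q ≥ 1`: `‖S(m) − (∫_1^q t^{-s} dt + c₀(s))‖ ≤ |log q − log m| + 1/(2m) + ‖s(s+1)‖/(16 m²)`
(Euler–Maclaurin `powSum_eq_powInt_add` plus `‖∫_m^q t^{-s}‖ ≤ |log q − log m|`). [folklore] -/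
theorem norm_powSum_sub_powInt_sub_emConst_le {s : ℂ} (hs : s.re = 1) {m : ℕ} (hm : 1 ≤ m)
    {q : ℝ} (hq : 1 ≤ q) :
    ‖powSum s m - (powInt s q + emConst s)‖ ≤
      |Real.log q - Real.log m| + 1 / (2 * m) + ‖s * (s + 1)‖ / (16 * (m : ℝ) ^ 2) := by
  have hm1 : (1 : ℝ) ≤ m := by exact_mod_cast hm
  have hm0 : (0 : ℝ) < m := by linarith
  rw [powSum_eq_powInt_add hs hm]
  have h1 : ‖powInt s m - powInt s q‖ ≤ |Real.log q - Real.log m| := by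
    rcases le_total (m : ℝ) q with hle | hle
    · rw [norm_sub_rev]
      refine (norm_powInt_sub_powInt_le hs hm1 hle).trans (le_abs_self _)
    · refine (norm_powInt_sub_powInt_le hs hq hle).trans ?_
      rw [abs_sub_comm]; exact le_abs_self _
  have h2 : ‖npow s m / 2‖ = 1 / (2 * m) := by
    rw [norm_div, norm_npow_of_re_eq_one hs hm0]
    simp
    ring
  have h3 := norm_emTail_le hs hm
  calc ‖powInt s m + emConst s + npow s m / 2 + emTail s m - (powInt s q + emConst s)‖
      = ‖(powInt s m - powInt s q) + npow s m / 2 + emTail s m‖ := by ring_nf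
    _ ≤ ‖powInt s m - powInt s q‖ + ‖npow s m / 2‖ + ‖emTail s m‖ := norm_add₃_le
    _ ≤ _ := by rw [h2]; exact add_le_add (add_le_add h1 le_rfl) h3

/-- **Index bounds, ceiling version.** For a natural `N`, a real `t > 0` and `k = ⌈t⌉`,
`m = N / k` (natural division) satisfies `m ≤ N/t` and `N/(t+1) < m + 1`. [folklore] -/
theorem div_ceil_bounds (N : ℕ) {t : ℝ} (ht : 0 < t) :
    ((N / ⌈t⌉₊ : ℕ) : ℝ) ≤ N / t ∧ (N : ℝ) / (t + 1) < (N / ⌈t⌉₊ : ℕ) + 1 := by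
  set k := ⌈t⌉₊ with hk
  have hk1 : 1 ≤ k := Nat.one_le_iff_ne_zero.2 (Nat.ceil_pos.2 ht).ne'
  have hkR : (0 : ℝ) < k := by exact_mod_cast hk1
  have htk : t ≤ k := Nat.le_ceil t
  have hkt : (k : ℝ) < t + 1 := Nat.ceil_lt_add_one ht.le
  constructor
  · calc ((N / k : ℕ) : ℝ) ≤ (N : ℝ) / k := Nat.cast_div_le
      _ ≤ N / t := div_le_div_of_nonneg_left (Nat.cast_nonneg N) ht htk
  · have h1 : (N : ℝ) / k < (N / k : ℕ) + 1 := by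
      have := Nat.lt_div_mul_add (a := N) hk1
      have h2 : (N : ℝ) < ((N / k : ℕ) + 1 : ℝ) * k := by
        have : (N : ℝ) < ((N / k * k + k : ℕ) : ℝ) := by exact_mod_cast this
        push_cast at this
        linarith
      rwa [div_lt_iff₀ hkR]
    calc (N : ℝ) / (t + 1) ≤ N / k := div_le_div_of_nonneg_left (Nat.cast_nonneg N) hkR hkt.le
      _ < _ := h1

/-- **Index bounds, floor version.** For a real `t ≥ 1` and `k = ⌊t⌋`, `m = N / k` satisfies
`m ≤ N/(t−1)` when `t > 1` (stated as `m (t − 1) ≤ N`) and `N/t < m + 1`. [folklore] -/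
theorem div_floor_bounds (N : ℕ) {t : ℝ} (ht : 1 ≤ t) :
    ((N / ⌊t⌋₊ : ℕ) : ℝ) * (t - 1) ≤ N ∧ (N : ℝ) / t < (N / ⌊t⌋₊ : ℕ) + 1 := by
  set k := ⌊t⌋₊ with hk
  have hk1 : 1 ≤ k := Nat.le_floor (by exact_mod_cast ht)
  have hkR : (0 : ℝ) < k := by exact_mod_cast hk1
  have hkt : (k : ℝ) ≤ t := Nat.floor_le (by linarith)
  have htk : t < k + 1 := Nat.lt_floor_add_one t
  constructor
  · have h1 : ((N / k : ℕ) : ℝ) * k ≤ N := by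
      have : ((N / k * k : ℕ) : ℝ) ≤ N := by exact_mod_cast Nat.div_mul_le_self N k
      push_cast at this; exact this
    calc ((N / k : ℕ) : ℝ) * (t - 1) ≤ ((N / k : ℕ) : ℝ) * k :=
          mul_le_mul_of_nonneg_left (by linarith) (Nat.cast_nonneg _)
      _ ≤ N := h1
  · have h1 : (N : ℝ) / k < (N / k : ℕ) + 1 := by
      have := Nat.lt_div_mul_add (a := N) hk1
      have h2 : (N : ℝ) < ((N / k : ℕ) + 1 : ℝ) * k := by
        have : (N : ℝ) < ((N / k * k + k : ℕ) : ℝ) := by exact_mod_cast this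
        push_cast at this
        linarith
      rwa [div_lt_iff₀ hkR]
    calc (N : ℝ) / t ≤ N / k := div_le_div_of_nonneg_left (Nat.cast_nonneg N) hkR hkt
      _ < _ := h1

/-- The block index is at least `1` as long as `k ≤ N`: for `1 ≤ k ≤ N`, `1 ≤ N / k`. [folklore] -/
theorem one_le_div_of_le {N k : ℕ} (hk : 1 ≤ k) (hkN : k ≤ N) : 1 ≤ N / k :=
  (Nat.one_le_div_iff (by omega)).2 hkN

/-- The block index is at most `√N` beyond `√N`: for `k > Nat.sqrt N`, `N / k ≤ Nat.sqrt N`.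
[folklore] -/
theorem div_le_sqrt_of_sqrt_lt {N k : ℕ} (hk : Nat.sqrt N < k) : N / k ≤ Nat.sqrt N := by
  have h1 : N / k ≤ N / (Nat.sqrt N + 1) := Nat.div_le_div_left (by omega) (by omega)
  have h2 : N / (Nat.sqrt N + 1) < Nat.sqrt N + 1 := Nat.div_lt_of_lt_mul (Nat.lt_succ_sqrt N)
  omega

/-! ## The two kernels and their derivative majorants -/

/-- `h_B(t) = t^{-s}/log t`, `s = 1 + iτ`: the weight of the `B`-side integer sum. [folklore] -/
def hB (τ : ℝ) (t : ℝ) : ℂ := npow (1 + τ * I) t / (Real.log t : ℂ)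

/-- `D_B(t) = (‖s‖ log t + 1)/(t² log² t)`: majorant of `‖h_B'‖`. [folklore] -/
def DB (τ : ℝ) (t : ℝ) : ℝ := (‖(1 : ℂ) + τ * I‖ * Real.log t + 1) / (t ^ 2 * Real.log t ^ 2)

/-- `h_R(t) = 1/(t log t)` (as a complex number): the weight of the `R`-side integer sum.
[folklore] -/
def hR (t : ℝ) : ℂ := (((t * Real.log t)⁻¹ : ℝ) : ℂ)

/-- `D_R(t) = (log t + 1)/(t² log² t)`: majorant of `‖h_R'‖` (indeed `= |h_R'|`). [folklore] -/
def DR (t : ℝ) : ℝ := (Real.log t + 1) / (t ^ 2 * Real.log t ^ 2)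

/-- The derivative of `h_B` on `t > 1` (quotient rule, in the form Mathlib produces it).
[folklore] -/
theorem hasDerivAt_hB (τ : ℝ) {t : ℝ} (ht : 1 < t) :
    HasDerivAt (hB τ) ((-(1 + τ * I) * npow (1 + τ * I + 1) t * (Real.log t : ℂ) -
      npow (1 + τ * I) t * ((t⁻¹ : ℝ) : ℂ)) / (Real.log t : ℂ) ^ 2) t := by
  have ht0 : 0 < t := by linarith
  have hlog : (Real.log t : ℂ) ≠ 0 := by
    rw [Ne, Complex.ofReal_eq_zero]; exact (Real.log_pos ht).ne'
  have h1 := hasDerivAt_npow (1 + τ * I) ht0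
  have h2 : HasDerivAt (fun x : ℝ ↦ (Real.log x : ℂ)) ((t⁻¹ : ℝ) : ℂ) t :=
    (Real.hasDerivAt_log ht0.ne').ofReal_comp
  exact h1.div h2 hlog

/-- `‖h_B'(t)‖ ≤ D_B(t)` for `t > 1`. [folklore] -/
theorem norm_deriv_hB_le (τ : ℝ) {t : ℝ} (ht : 1 < t) :
    ‖(-(1 + τ * I) * npow (1 + τ * I + 1) t * (Real.log t : ℂ) -
      npow (1 + τ * I) t * ((t⁻¹ : ℝ) : ℂ)) / (Real.log t : ℂ) ^ 2‖ ≤ DB τ t := by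
  have ht0 : 0 < t := by linarith
  have hlog : 0 < Real.log t := Real.log_pos ht
  have hs : ((1 : ℂ) + τ * I).re = 1 := by simp
  have hn1 : ‖npow (1 + τ * I + 1) t‖ = t⁻¹ * t⁻¹ := by
    rw [npow_add_one _ ht0, norm_mul, norm_npow_of_re_eq_one hs ht0, Complex.norm_real,
      Real.norm_eq_abs, abs_of_pos (inv_pos.2 ht0)]
  have hn2 : ‖npow (1 + τ * I) t‖ = t⁻¹ := norm_npow_of_re_eq_one hs ht0
  have hlogn : ‖(Real.log t : ℂ)‖ = Real.log t := by
    rw [Complex.norm_real, Real.norm_eq_abs, abs_of_pos hlog]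
  have hinv : ‖((t⁻¹ : ℝ) : ℂ)‖ = t⁻¹ := by
    rw [Complex.norm_real, Real.norm_eq_abs, abs_of_pos (inv_pos.2 ht0)]
  set c := ‖(1 : ℂ) + τ * I‖ with hc
  have hc0 : 0 ≤ c := norm_nonneg _
  rw [norm_div, norm_pow, hlogn]
  have hnum : ‖-(1 + τ * I) * npow (1 + τ * I + 1) t * (Real.log t : ℂ) -
      npow (1 + τ * I) t * ((t⁻¹ : ℝ) : ℂ)‖ ≤ c * (t⁻¹ * t⁻¹) * Real.log t + t⁻¹ * t⁻¹ := by
    refine (norm_sub_le _ _).trans (le_of_eq ?_)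
    rw [norm_mul, norm_mul, norm_neg, hn1, hlogn, norm_mul, hn2, hinv]
  refine (div_le_div_of_nonneg_right hnum (by positivity)).trans (le_of_eq ?_)
  rw [DB, ← hc]
  field_simp

/-- `D_B ≥ 0` on `t > 1`. [folklore] -/
theorem DB_nonneg (τ : ℝ) {t : ℝ} (ht : 1 < t) : 0 ≤ DB τ t := by
  unfold DB
  have := Real.log_pos ht
  positivity

/-- `D_B` is antitone on `[a, ∞)` for `a > 1`. [folklore] -/
theorem DB_antitoneOn (τ : ℝ) {a : ℝ} (ha : 1 < a) : AntitoneOn (DB τ) (Ici a) := by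
  intro x hx y hy hxy
  have hx1 : 1 < x := lt_of_lt_of_le ha hx
  have hy1 : 1 < y := lt_of_lt_of_le ha hy
  have hlx : 0 < Real.log x := Real.log_pos hx1
  have hly : 0 < Real.log y := Real.log_pos hy1
  have hlxy : Real.log x ≤ Real.log y := Real.log_le_log (by linarith) hxy
  set c := ‖(1 : ℂ) + τ * I‖ with hc
  have hc0 : 0 ≤ c := norm_nonneg _
  -- `D_B(t) = c/(t² log t) + 1/(t² log² t)`, both pieces antitone
  have hsplit : ∀ t : ℝ, 1 < t → DB τ t = c / (t ^ 2 * Real.log t) + 1 / (t ^ 2 * Real.log t ^ 2) := by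
    intro t ht
    have hl : Real.log t ≠ 0 := (Real.log_pos ht).ne'
    have ht0 : t ≠ 0 := by linarith
    unfold DB
    rw [← hc]
    field_simp
  rw [hsplit x hx1, hsplit y hy1]
  have h1 : x ^ 2 * Real.log x ≤ y ^ 2 * Real.log y :=
    mul_le_mul (pow_le_pow_left₀ (by linarith) hxy 2) hlxy hlx.le (by positivity)
  have h2 : x ^ 2 * Real.log x ^ 2 ≤ y ^ 2 * Real.log y ^ 2 :=
    mul_le_mul (pow_le_pow_left₀ (by linarith) hxy 2) (pow_le_pow_left₀ hlx.le hlxy 2)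
      (by positivity) (by positivity)
  exact add_le_add (div_le_div_of_nonneg_left hc0 (by positivity) h1)
    (div_le_div_of_nonneg_left zero_le_one (by positivity) h2)

/-- `D_B(t) ≤ (‖s‖/log a + 1/log² a) · t⁻²` for `t ≥ a > 1`. [folklore] -/
theorem DB_le_div_sq (τ : ℝ) {a t : ℝ} (ha : 1 < a) (hat : a ≤ t) :
    DB τ t ≤ (‖(1 : ℂ) + τ * I‖ / Real.log a + 1 / Real.log a ^ 2) * (t ^ 2)⁻¹ := by
  have ht1 : 1 < t := lt_of_lt_of_le ha hat
  have hla : 0 < Real.log a := Real.log_pos ha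
  have hlt : 0 < Real.log t := Real.log_pos ht1
  have hlat : Real.log a ≤ Real.log t := Real.log_le_log (by linarith) hat
  have hc0 : 0 ≤ ‖(1 : ℂ) + τ * I‖ := norm_nonneg _
  have ht2 : 0 < t ^ 2 := by positivity
  unfold DB
  rw [div_le_iff₀ (by positivity)]
  have hla2 : Real.log a ^ 2 ≤ Real.log t ^ 2 := pow_le_pow_left₀ hla.le hlat 2
  have e1 : ‖(1 : ℂ) + τ * I‖ * Real.log t ≤ ‖(1 : ℂ) + τ * I‖ / Real.log a * (t ^ 2)⁻¹ *
      (t ^ 2 * Real.log t ^ 2) := by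
    rw [show ‖(1 : ℂ) + τ * I‖ / Real.log a * (t ^ 2)⁻¹ * (t ^ 2 * Real.log t ^ 2) =
      ‖(1 : ℂ) + τ * I‖ * Real.log t * (Real.log t / Real.log a) by field_simp]
    have : (1 : ℝ) ≤ Real.log t / Real.log a := by rwa [le_div_iff₀ hla, one_mul]
    nlinarith [mul_nonneg hc0 hlt.le]
  have e2 : (1 : ℝ) ≤ 1 / Real.log a ^ 2 * (t ^ 2)⁻¹ * (t ^ 2 * Real.log t ^ 2) := by
    rw [show 1 / Real.log a ^ 2 * (t ^ 2)⁻¹ * (t ^ 2 * Real.log t ^ 2) =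
      Real.log t ^ 2 / Real.log a ^ 2 by field_simp]
    rwa [le_div_iff₀ (by positivity), one_mul]
  nlinarith

/-- **`∫_a^b D_B ≤ (‖s‖/log a + 1/log² a)/a`** for `1 < a ≤ b`. [folklore] -/
theorem integral_DB_le (τ : ℝ) {a b : ℝ} (ha : 1 < a) (hab : a ≤ b) :
    ∫ t in a..b, DB τ t ≤ (‖(1 : ℂ) + τ * I‖ / Real.log a + 1 / Real.log a ^ 2) / a := by
  have ha0 : 0 < a := by linarith
  set c := ‖(1 : ℂ) + τ * I‖ / Real.log a + 1 / Real.log a ^ 2 with hc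
  have hc0 : 0 ≤ c := by
    have := Real.log_pos ha
    positivity
  have hlogc : ContinuousOn Real.log (Icc a b) :=
    Real.continuousOn_log.mono fun t ht ↦ (lt_of_lt_of_le ha0 ht.1).ne'
  have hcont : ContinuousOn (DB τ) (Icc a b) := by
    have hnum : ContinuousOn (fun t : ℝ ↦ ‖(1 : ℂ) + τ * I‖ * Real.log t + 1) (Icc a b) :=
      (continuousOn_const.mul hlogc).add continuousOn_const
    have hden : ContinuousOn (fun t : ℝ ↦ t ^ 2 * Real.log t ^ 2) (Icc a b) :=
      (continuousOn_pow 2).mul (hlogc.pow 2)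
    refine hnum.div hden fun t ht ↦ ?_
    have ht0 : 0 < t := lt_of_lt_of_le ha0 ht.1
    have := Real.log_pos (lt_of_lt_of_le ha ht.1)
    positivity
  have hint : IntervalIntegrable (DB τ) volume a b := hcont.intervalIntegrable_of_Icc hab
  have hint2 : IntervalIntegrable (fun t : ℝ ↦ c * (t ^ 2)⁻¹) volume a b := by
    refine (ContinuousOn.intervalIntegrable_of_Icc hab ?_)
    refine continuousOn_const.mul (ContinuousOn.inv₀ (by fun_prop) fun t ht ↦ ?_)
    have : 0 < t := lt_of_lt_of_le ha0 ht.1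
    positivity
  calc ∫ t in a..b, DB τ t ≤ ∫ t in a..b, c * (t ^ 2)⁻¹ :=
        intervalIntegral.integral_mono_on hab hint hint2 fun t ht ↦ DB_le_div_sq τ ha ht.1
    _ = c * (a⁻¹ - b⁻¹) := by
        rw [intervalIntegral.integral_const_mul]
        congr 1
        have : ∫ t in a..b, (t ^ 2)⁻¹ = ∫ t in a..b, t ^ (-2 : ℤ) := by
          refine intervalIntegral.integral_congr fun t _ ↦ ?_
          show (t ^ 2)⁻¹ = t ^ (-2 : ℤ)
          rw [zpow_neg]
          norm_cast
        rw [this, integral_zpow (Or.inr ⟨by norm_num, ?_⟩)]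
        · norm_num
          field_simp
          ring
        · rw [uIcc_of_le hab]; exact fun h ↦ absurd h.1 (not_le.2 ha0)
    _ ≤ c / a := by
        rw [div_eq_mul_inv]
        refine mul_le_mul_of_nonneg_left ?_ hc0
        have : 0 ≤ b⁻¹ := inv_nonneg.2 (by linarith)
        linarith

/-- The derivative of `h_R` on `t > 1`. [folklore] -/
theorem hasDerivAt_hR {t : ℝ} (ht : 1 < t) :
    HasDerivAt hR ((( -(Real.log t + 1) / (t * Real.log t) ^ 2 : ℝ)) : ℂ) t := by
  have ht0 : 0 < t := by linarith
  have hlog : 0 < Real.log t := Real.log_pos ht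
  have h1 : HasDerivAt (fun x : ℝ ↦ x * Real.log x) (1 * Real.log t + t * t⁻¹) t :=
    (hasDerivAt_id t).mul (Real.hasDerivAt_log ht0.ne')
  have h2 := h1.inv (by positivity : t * Real.log t ≠ 0)
  have heq : (1 * Real.log t + t * t⁻¹) = Real.log t + 1 := by field_simp
  rw [heq] at h2
  unfold hR
  exact h2.ofReal_comp

/-- `‖h_R'(t)‖ ≤ D_R(t)` (`t > 1`). [folklore] -/
theorem norm_deriv_hR_le {t : ℝ} (ht : 1 < t) :
    ‖((( -(Real.log t + 1) / (t * Real.log t) ^ 2 : ℝ)) : ℂ)‖ ≤ DR t := by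
  have ht0 : 0 < t := by linarith
  have hlog : 0 < Real.log t := Real.log_pos ht
  rw [Complex.norm_real, Real.norm_eq_abs, abs_div, abs_neg, abs_of_pos (by positivity),
    abs_of_pos (by positivity), DR, mul_pow]

/-- `D_R ≥ 0` on `t > 1`. [folklore] -/
theorem DR_nonneg {t : ℝ} (ht : 1 < t) : 0 ≤ DR t := by
  unfold DR
  have := Real.log_pos ht
  positivity

/-- `D_R = D_B` at `τ`-norm `1`: `D_R t ≤ D_B τ t` (since `‖1 + iτ‖ ≥ 1`); we mostly use `D_R`
through its own antitonicity. `D_R` is antitone on `[a, ∞)`, `a > 1`. [folklore] -/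
theorem DR_antitoneOn {a : ℝ} (ha : 1 < a) : AntitoneOn DR (Ici a) := by
  have h := DB_antitoneOn 0 ha
  have heq : ∀ t, DB 0 t = DR t := by
    intro t; simp [DB, DR]
  intro x hx y hy hxy
  have := h hx hy hxy
  rwa [heq, heq] at this

/-- **`∫_a^b D_R ≤ (1/log a + 1/log² a)/a`** for `1 < a ≤ b`. [folklore] -/
theorem integral_DR_le {a b : ℝ} (ha : 1 < a) (hab : a ≤ b) :
    ∫ t in a..b, DR t ≤ (1 / Real.log a + 1 / Real.log a ^ 2) / a := by
  have h := integral_DB_le 0 ha hab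
  have heq : ∀ t, DB 0 t = DR t := by
    intro t; simp [DB, DR]
  simp_rw [heq] at h
  simpa using h

/-! ## The step integrands -/

/-- `stepC G N t = G(N/⌈t⌉)`: a value attached to the block of `t`, as a step function of the real
variable `t` (on `(n − 1, n]` it is `G(N/n)`); used with `G = S = powSum s` and with
`G = ‖S‖`. [folklore] -/
def stepC (G : ℕ → ℂ) (N : ℕ) (t : ℝ) : ℂ := G (N / ⌈t⌉₊)

/-- `stepF G N t = G(N/⌊t⌋)`; on `[n, n + 1)` it is `G(N/n)`. [folklore] -/
def stepF (G : ℕ → ℂ) (N : ℕ) (t : ℝ) : ℂ := G (N / ⌊t⌋₊)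

/-- On `(n − 1, n]` (`n ≥ 1`), `stepC = G(N/n)`. [folklore] -/
theorem stepC_eq (G : ℕ → ℂ) (N : ℕ) {n : ℕ} (hn : 1 ≤ n) {t : ℝ} (ht : t ∈ Ioc ((n : ℝ) - 1) n) :
    stepC G N t = G (N / n) := by
  unfold stepC
  rw [(Nat.ceil_eq_iff (by omega : n ≠ 0)).2 ⟨by push_cast [Nat.cast_sub hn]; exact ht.1, ht.2⟩]

/-- On `[n, n + 1)`, `stepF = G(N/n)`. [folklore] -/
theorem stepF_eq (G : ℕ → ℂ) (N : ℕ) {n : ℕ} {t : ℝ} (ht : t ∈ Ico (n : ℝ) (n + 1)) :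
    stepF G N t = G (N / n) := by
  unfold stepF
  have ht0 : 0 ≤ t := le_trans (Nat.cast_nonneg n) ht.1
  rw [(Nat.floor_eq_iff ht0).2 ⟨ht.1, ht.2⟩]

/-- `stepC` is measurable. [folklore] -/
theorem measurable_stepC (G : ℕ → ℂ) (N : ℕ) : Measurable (stepC G N) :=
  (measurable_from_nat (f := fun k : ℕ ↦ G (N / k))).comp Nat.measurable_ceil

/-- `stepF` is measurable. [folklore] -/
theorem measurable_stepF (G : ℕ → ℂ) (N : ℕ) : Measurable (stepF G N) :=
  (measurable_from_nat (f := fun k : ℕ ↦ G (N / k))).comp Nat.measurable_floor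

/-- A continuous function times a bounded measurable one is integrable on a compact interval:
`h · stepC` is interval integrable on `[a, b]` when `h` is continuous there and `G(N/k)` is
bounded. [folklore] -/
theorem intervalIntegrable_mul_stepC {G : ℕ → ℂ} {N : ℕ} {C : ℝ} (hGC : ∀ k : ℕ, ‖G (N / k)‖ ≤ C)
    {h : ℝ → ℂ} {a b : ℝ} (hab : a ≤ b) (hh : ContinuousOn h (Icc a b)) :
    IntervalIntegrable (fun t ↦ h t * stepC G N t) volume a b := by
  obtain ⟨C', hC'⟩ := (isCompact_Icc (a := a) (b := b)).exists_bound_of_continuousOn hh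
  rw [intervalIntegrable_iff_integrableOn_Icc_of_le hab]
  have hmeas : AEStronglyMeasurable (fun t ↦ h t * stepC G N t) (volume.restrict (Icc a b)) :=
    (hh.aestronglyMeasurable measurableSet_Icc).mul
      (measurable_stepC G N).aestronglyMeasurable
  have hC0 : 0 ≤ C := (norm_nonneg _).trans (hGC 1)
  refine Integrable.mono' (integrable_const (max C' 0 * C)) hmeas ?_
  filter_upwards [ae_restrict_mem measurableSet_Icc] with t ht
  rw [norm_mul]
  exact mul_le_mul ((hC' t ht).trans (le_max_left _ _)) (hGC _) (norm_nonneg _)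
    (le_max_right _ _)

/-- The same for `stepF`. [folklore] -/
theorem intervalIntegrable_mul_stepF {G : ℕ → ℂ} {N : ℕ} {C : ℝ} (hGC : ∀ k : ℕ, ‖G (N / k)‖ ≤ C)
    {h : ℝ → ℂ} {a b : ℝ} (hab : a ≤ b) (hh : ContinuousOn h (Icc a b)) :
    IntervalIntegrable (fun t ↦ h t * stepF G N t) volume a b := by
  obtain ⟨C', hC'⟩ := (isCompact_Icc (a := a) (b := b)).exists_bound_of_continuousOn hh
  rw [intervalIntegrable_iff_integrableOn_Icc_of_le hab]
  have hmeas : AEStronglyMeasurable (fun t ↦ h t * stepF G N t) (volume.restrict (Icc a b)) :=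
    (hh.aestronglyMeasurable measurableSet_Icc).mul
      (measurable_stepF G N).aestronglyMeasurable
  have hC0 : 0 ≤ C := (norm_nonneg _).trans (hGC 1)
  refine Integrable.mono' (integrable_const (max C' 0 * C)) hmeas ?_
  filter_upwards [ae_restrict_mem measurableSet_Icc] with t ht
  rw [norm_mul]
  exact mul_le_mul ((hC' t ht).trans (le_max_left _ _)) (hGC _) (norm_nonneg _)
    (le_max_right _ _)

/-- The bound `‖S(N/k)‖ ≤ N` for every `k` (`‖S(m)‖ ≤ m ≤ N`), feeding the integrability lemmas
with `G = powSum s`. [folklore] -/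
theorem norm_powSum_div_le {s : ℂ} (hs : s.re = 1) (N k : ℕ) : ‖powSum s (N / k)‖ ≤ N := by
  exact (norm_powSum_le_self hs _).trans (by exact_mod_cast Nat.div_le_self N k)

/-! ## The sum against the integral of the step integrand -/

/-- On a unit interval the step factor is constant:
`∫_{n-1}^{n} h · stepC = G(N/n) ∫_{n-1}^{n} h` (`n ≥ 1`). [folklore] -/
theorem integral_unit_mul_stepC (G : ℕ → ℂ) (N : ℕ) (h : ℝ → ℂ) {n : ℕ} (hn : 1 ≤ n) :
    ∫ t in ((n : ℝ) - 1)..n, h t * stepC G N t = G (N / n) * ∫ t in ((n : ℝ) - 1)..n, h t := by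
  have hle : (n : ℝ) - 1 ≤ n := by linarith
  rw [intervalIntegral.integral_of_le hle, intervalIntegral.integral_of_le hle,
    ← MeasureTheory.integral_const_mul]
  refine setIntegral_congr_fun measurableSet_Ioc fun t ht ↦ ?_
  rw [stepC_eq G N hn ht, mul_comm]

/-- **The integer sum against the integral of the step integrand.** For naturals `M ≤ b`, `h`
differentiable on `[M, b]` with `‖h'‖ ≤ D` (`D` antitone on `[M, b]`), `G(N/·)` bounded, and
`‖G(N/n)‖ ≤ Gb` for `M < n ≤ b`:
`‖∑_{M<n≤b} h(n) G(N/n) − ∫_M^b h · stepC‖ ≤ (Gb/2) ∑_{M<n≤b} D(n−1)`. [folklore] -/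
theorem norm_sum_sub_integral_stepC_le {G : ℕ → ℂ} {N : ℕ} {C : ℝ} (hGC : ∀ k : ℕ, ‖G (N / k)‖ ≤ C)
    {h h' : ℝ → ℂ} {D : ℝ → ℝ} {M b : ℕ}
    (hMb : M ≤ b) (hderiv : ∀ t ∈ Icc (M : ℝ) b, HasDerivAt h (h' t) t)
    (hD : ∀ t ∈ Icc (M : ℝ) b, ‖h' t‖ ≤ D t) (hDanti : AntitoneOn D (Icc (M : ℝ) b))
    {Gb : ℝ} (hG : ∀ n ∈ Finset.Ioc M b, ‖G (N / n)‖ ≤ Gb) :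
    ‖∑ n ∈ Finset.Ioc M b, h n * G (N / n) - ∫ t in (M : ℝ)..b, h t * stepC G N t‖ ≤
      Gb / 2 * ∑ n ∈ Finset.Ioc M b, D ((n : ℝ) - 1) := by
  induction b, hMb using Nat.le_induction with
  | base => simp
  | succ b hb ih =>
    have hb' : (M : ℝ) ≤ b := by exact_mod_cast hb
    have hbb : (b : ℝ) ≤ ((b + 1 : ℕ) : ℝ) := by push_cast; linarith
    have hsub : Icc (M : ℝ) b ⊆ Icc (M : ℝ) ((b + 1 : ℕ) : ℝ) := fun t ht ↦ ⟨ht.1, ht.2.trans hbb⟩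
    have hsub' : Icc (b : ℝ) ((b + 1 : ℕ) : ℝ) ⊆ Icc (M : ℝ) ((b + 1 : ℕ) : ℝ) := fun t ht ↦
      ⟨hb'.trans ht.1, ht.2⟩
    have hcont : ContinuousOn h (Icc (M : ℝ) ((b + 1 : ℕ) : ℝ)) := fun t ht ↦
      (hderiv t ht).continuousAt.continuousWithinAt
    have hGb' : ∀ n ∈ Finset.Ioc M b, ‖G (N / n)‖ ≤ Gb := fun n hn ↦
      hG n (Finset.Ioc_subset_Ioc_right (by omega) hn)
    have ih' := ih (fun t ht ↦ hderiv t (hsub ht)) (fun t ht ↦ hD t (hsub ht)) (hDanti.mono hsub)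
      hGb'
    have hint1 : IntervalIntegrable (fun t ↦ h t * stepC G N t) volume (M : ℝ) b :=
      intervalIntegrable_mul_stepC hGC hb' (hcont.mono hsub)
    have hint2 : IntervalIntegrable (fun t ↦ h t * stepC G N t) volume (b : ℝ) ((b + 1 : ℕ) : ℝ) :=
      intervalIntegrable_mul_stepC hGC hbb (hcont.mono hsub')
    have hmem : b + 1 ∈ Finset.Ioc M (b + 1) := Finset.mem_Ioc.2 ⟨by omega, le_rfl⟩
    have hG1 : ‖G (N / (b + 1))‖ ≤ Gb := hG (b + 1) hmem
    rw [Finset.sum_Ioc_succ_top (by omega), Finset.sum_Ioc_succ_top (by omega),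
      ← integral_add_adjacent_intervals hint1 hint2]
    -- the unit piece
    have hunit : ∫ t in (b : ℝ)..((b + 1 : ℕ) : ℝ), h t * stepC G N t =
        G (N / (b + 1)) * ∫ t in (b : ℝ)..((b + 1 : ℕ) : ℝ), h t := by
      have := integral_unit_mul_stepC G N h (n := b + 1) (by omega)
      push_cast at this ⊢
      simpa using this
    have hpiece : ‖h ((b + 1 : ℕ) : ℝ) - ∫ t in (b : ℝ)..((b + 1 : ℕ) : ℝ), h t‖ ≤ 1 / 2 * D b := by
      have h1 := norm_sum_Ioc_sub_integral_le (a := b) (b := b + 1) (by omega)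
        (fun t ht ↦ hderiv t (hsub' ht)) (fun t ht ↦ hD t (hsub' ht)) (hDanti.mono hsub')
      simp only [Nat.Ioc_succ_singleton, Finset.sum_singleton] at h1
      push_cast at h1 ⊢
      simpa using h1
    have hDb : D (((b + 1 : ℕ) : ℝ) - 1) = D b := by push_cast; ring_nf
    have hnn : 0 ≤ ‖h ((b + 1 : ℕ) : ℝ) - ∫ t in (b : ℝ)..((b + 1 : ℕ) : ℝ), h t‖ := norm_nonneg _
    calc ‖∑ n ∈ Finset.Ioc M b, h n * G (N / n) + h ((b + 1 : ℕ) : ℝ) * G (N / (b + 1)) -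
          ((∫ t in (M : ℝ)..b, h t * stepC G N t) +
            ∫ t in (b : ℝ)..((b + 1 : ℕ) : ℝ), h t * stepC G N t)‖
        = ‖(∑ n ∈ Finset.Ioc M b, h n * G (N / n) - ∫ t in (M : ℝ)..b, h t * stepC G N t) +
            (h ((b + 1 : ℕ) : ℝ) - ∫ t in (b : ℝ)..((b + 1 : ℕ) : ℝ), h t) * G (N / (b + 1))‖ := by
          rw [hunit]; ring_nf
      _ ≤ ‖∑ n ∈ Finset.Ioc M b, h n * G (N / n) - ∫ t in (M : ℝ)..b, h t * stepC G N t‖ +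
            ‖h ((b + 1 : ℕ) : ℝ) - ∫ t in (b : ℝ)..((b + 1 : ℕ) : ℝ), h t‖ * ‖G (N / (b + 1))‖ := by
          refine (norm_add_le _ _).trans (add_le_add le_rfl ?_)
          rw [norm_mul]
      _ ≤ Gb / 2 * ∑ n ∈ Finset.Ioc M b, D ((n : ℝ) - 1) + 1 / 2 * D b * Gb :=
          add_le_add ih' (mul_le_mul hpiece hG1 (norm_nonneg _) (by linarith [hpiece]))
      _ = Gb / 2 * (∑ n ∈ Finset.Ioc M b, D ((n : ℝ) - 1) + D (((b + 1 : ℕ) : ℝ) - 1)) := by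
          rw [hDb]; ring

/-- **The `D`-sums**: for `D` antitone and nonnegative on `[M, b]`,
`∑_{M<n≤b} D(n − 1) ≤ D(M) + ∫_M^b D`. [folklore] -/
theorem sum_D_le {D : ℝ → ℝ} {M b : ℕ} (hMb : M ≤ b) (hDanti : AntitoneOn D (Icc (M : ℝ) b))
    (hD0 : ∀ t ∈ Icc (M : ℝ) b, 0 ≤ D t) :
    ∑ n ∈ Finset.Ioc M b, D ((n : ℝ) - 1) ≤ D M + ∫ t in (M : ℝ)..b, D t := by
  rcases Nat.eq_or_lt_of_le hMb with rfl | hlt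
  · simp
    exact hD0 M ⟨le_rfl, by exact_mod_cast le_rfl⟩
  -- reindex: `∑_{M<n≤b} D(n-1) = D(M) + ∑_{i ∈ Ico M (b-1)} D(i+1)`
  have hre : ∑ n ∈ Finset.Ioc M b, D ((n : ℝ) - 1) =
      D M + ∑ i ∈ Finset.Ico M (b - 1), D ((i + 1 : ℕ) : ℝ) := by
    have h1 : Finset.Ioc M b = insert (M + 1) (Finset.Ioc (M + 1) b) := by
      ext n; simp only [Finset.mem_Ioc, Finset.mem_insert]; omega
    rw [h1, Finset.sum_insert (by simp)]
    push_cast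
    ring_nf
    congr 1
    refine Finset.sum_nbij' (fun n ↦ n - 2) (fun i ↦ i + 2) ?_ ?_ ?_ ?_ ?_
    · intro n hn; simp only [Finset.mem_Ioc] at hn; simp only [Finset.mem_Ico]; omega
    · intro i hi; simp only [Finset.mem_Ico] at hi; simp only [Finset.mem_Ioc]; omega
    · intro n hn; simp only [Finset.mem_Ioc] at hn; omega
    · intro i hi; omega
    · intro n hn
      simp only [Finset.mem_Ioc] at hn
      congr 1
      have : 2 ≤ n := by omega
      rw [Nat.cast_sub this]
      push_cast
      ring
  rw [hre]
  have hb1 : M ≤ b - 1 := by omega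
  have hanti : AntitoneOn D (Icc (M : ℝ) ((b - 1 : ℕ) : ℝ)) :=
    hDanti.mono fun t ht ↦ ⟨ht.1, ht.2.trans (by exact_mod_cast Nat.sub_le b 1)⟩
  have h2 := AntitoneOn.sum_le_integral_Ico hb1 hanti
  have h3 : ∫ t in (M : ℝ)..((b - 1 : ℕ) : ℝ), D t ≤ ∫ t in (M : ℝ)..b, D t := by
    have hbb : ((b - 1 : ℕ) : ℝ) ≤ b := by exact_mod_cast Nat.sub_le b 1
    have hMb1 : (M : ℝ) ≤ ((b - 1 : ℕ) : ℝ) := by exact_mod_cast hb1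
    have hMbR : (M : ℝ) ≤ b := by exact_mod_cast hMb
    have hint : IntervalIntegrable D volume (M : ℝ) b := by
      apply AntitoneOn.intervalIntegrable
      rw [uIcc_of_le hMbR]
      exact hDanti
    refine intervalIntegral.integral_mono_interval le_rfl hMb1 hbb ?_ hint
    filter_upwards [ae_restrict_mem measurableSet_Ioc] with t ht
    exact hD0 t ⟨ht.1.le, ht.2⟩
  linarith

/-! ## Weighted sums against integrals (general form) -/

/-- **`∑_{a≤n<b} e(n) c(n) ≤ ∫_a^b e·P`** when `c(n) ≤ ∫_n^{n+1} P`, `P ≥ 0`, `e ≥ 0` non-decreasing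
(the general form of `sum_mul_norm_sub_le_integral`). [folklore] -/
theorem sum_mul_le_integral_of_le {c : ℕ → ℝ} {e P : ℝ → ℝ} {a b : ℕ} (hab : a ≤ b)
    (hc : ∀ n : ℕ, a ≤ n → n < b → c n ≤ ∫ t in (n : ℝ)..(n + 1), P t)
    (hP : ∀ t : ℝ, (a : ℝ) ≤ t → 0 ≤ P t)
    (he : ∀ n : ℕ, a ≤ n → ∀ t : ℝ, (n : ℝ) ≤ t → e n ≤ e t)
    (he0 : ∀ n : ℕ, a ≤ n → 0 ≤ e n)
    (hint : ∀ n : ℕ, a ≤ n → n < b → IntervalIntegrable (fun t ↦ e t * P t) volume n (n + 1))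
    (hintP : ∀ n : ℕ, a ≤ n → n < b → IntervalIntegrable P volume n (n + 1)) :
    ∑ n ∈ Finset.Ico a b, e n * c n ≤ ∫ t in (a : ℝ)..b, e t * P t := by
  induction b, hab using Nat.le_induction with
  | base => simp
  | succ b hb ih =>
    have ih' := ih (fun n h1 h2 ↦ hc n h1 (by omega)) (fun n h1 h2 ↦ hint n h1 (by omega))
      (fun n h1 h2 ↦ hintP n h1 (by omega))
    have hstep : e b * c b ≤ ∫ t in (b : ℝ)..(b + 1), e t * P t := by
      have h1 : e b * c b ≤ e b * ∫ t in (b : ℝ)..(b + 1), P t :=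
        mul_le_mul_of_nonneg_left (hc b hb (by omega)) (he0 b hb)
      refine h1.trans ?_
      rw [← intervalIntegral.integral_const_mul]
      refine intervalIntegral.integral_mono_on (by linarith) ((hintP b hb (by omega)).const_mul _)
        (hint b hb (by omega)) fun t ht ↦ ?_
      exact mul_le_mul_of_nonneg_right (he b hb t ht.1)
        (hP t (le_trans (by exact_mod_cast hb) ht.1))
    have hadj : ∫ t in (a : ℝ)..((b + 1 : ℕ) : ℝ), e t * P t =
        (∫ t in (a : ℝ)..b, e t * P t) + ∫ t in (b : ℝ)..(b + 1), e t * P t := by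
      push_cast
      rw [integral_add_adjacent_intervals]
      · exact intervalIntegrable_of_unit_pieces hb fun n h1 h2 ↦ hint n h1 (by omega)
      · exact hint b hb (by omega)
    rw [Finset.sum_Ico_succ_top hb, hadj]
    exact add_le_add ih' hstep

/-- **`‖h(b) − h(a)‖ ≤ ∫_a^b D`** for `h` with continuous derivative `h'`, `‖h'‖ ≤ D` on `[a, b]`.
[folklore] -/
theorem norm_sub_le_integral {h h' : ℝ → ℂ} {D : ℝ → ℝ} {a b : ℝ} (hab : a ≤ b)
    (hderiv : ∀ t ∈ Icc a b, HasDerivAt h (h' t) t) (hcont : ContinuousOn h' (Icc a b))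
    (hD : ∀ t ∈ Icc a b, ‖h' t‖ ≤ D t) (hDint : IntervalIntegrable D volume a b) :
    ‖h b - h a‖ ≤ ∫ t in a..b, D t := by
  have hderiv' : ∀ t ∈ uIcc a b, HasDerivAt h (h' t) t := by
    rw [uIcc_of_le hab]; exact hderiv
  have hcont' : ContinuousOn h' (uIcc a b) := by rw [uIcc_of_le hab]; exact hcont
  rw [← integral_eq_sub_of_hasDerivAt hderiv' hcont'.intervalIntegrable]
  exact norm_integral_le_of_norm_le hab (Filter.Eventually.of_forall fun t ht ↦ hD t ⟨ht.1.le, ht.2⟩)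
    hDint

/-- The variation of a product sequence `g(n) = h(n) G(N/n)` splits into a jump part and a
smooth part: `‖g(n+1) − g(n)‖ ≤ ‖h(n+1)‖ ‖G(N/(n+1)) − G(N/n)‖ + ‖h(n+1) − h(n)‖ ‖G(N/n)‖`.
[folklore] -/
theorem norm_sub_mul_le (h : ℝ → ℂ) (G : ℕ → ℂ) (N n : ℕ) :
    ‖h (n + 1 : ℕ) * G (N / (n + 1)) - h n * G (N / n)‖ ≤
      ‖h (n + 1 : ℕ)‖ * ‖G (N / (n + 1)) - G (N / n)‖ + ‖h (n + 1 : ℕ) - h n‖ * ‖G (N / n)‖ := by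
  have : h (n + 1 : ℕ) * G (N / (n + 1)) - h n * G (N / n) =
      h (n + 1 : ℕ) * (G (N / (n + 1)) - G (N / n)) + (h (n + 1 : ℕ) - h n) * G (N / n) := by ring
  rw [this]
  refine (norm_add_le _ _).trans (le_of_eq ?_)
  rw [norm_mul, norm_mul]

/-- The smooth part against the step function: `‖h(n+1) − h(n)‖ ‖G(N/n)‖ ≤ ∫_n^{n+1} D · ‖stepF‖`
(the step factor is `G(N/n)` on `[n, n+1)`; `‖h(n+1) − h(n)‖ ≤ ∫_n^{n+1} D`). [folklore] -/
theorem norm_sub_mul_le_integral_stepF {h h' : ℝ → ℂ} {D : ℝ → ℝ} (G : ℕ → ℂ) (N n : ℕ)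
    (hderiv : ∀ t ∈ Icc (n : ℝ) (n + 1), HasDerivAt h (h' t) t)
    (hcont : ContinuousOn h' (Icc (n : ℝ) (n + 1)))
    (hD : ∀ t ∈ Icc (n : ℝ) (n + 1), ‖h' t‖ ≤ D t) (hDcont : ContinuousOn D (Icc (n : ℝ) (n + 1))) :
    ‖h (n + 1 : ℕ) - h n‖ * ‖G (N / n)‖ ≤ ∫ t in (n : ℝ)..(n + 1), D t * ‖stepF G N t‖ := by
  have hle : (n : ℝ) ≤ n + 1 := by linarith
  have h1 : ‖h (n + 1 : ℕ) - h n‖ ≤ ∫ t in (n : ℝ)..(n + 1), D t := by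
    have := norm_sub_le_integral hle hderiv hcont hD (hDcont.intervalIntegrable_of_Icc hle)
    push_cast at this ⊢
    exact this
  have h2 : ∫ t in (n : ℝ)..(n + 1), D t * ‖stepF G N t‖ =
      (∫ t in (n : ℝ)..(n + 1), D t) * ‖G (N / n)‖ := by
    rw [intervalIntegral.integral_of_le hle, intervalIntegral.integral_of_le hle,
      ← MeasureTheory.integral_mul_const, MeasureTheory.integral_Ioc_eq_integral_Ioo,
      MeasureTheory.integral_Ioc_eq_integral_Ioo]
    refine setIntegral_congr_fun measurableSet_Ioo fun t ht ↦ ?_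
    rw [stepF_eq G N ⟨ht.1.le, ht.2⟩]
  rw [h2]
  exact mul_le_mul_of_nonneg_right h1 (norm_nonneg _)

/-! ## The jumps of the block index -/

/-- Beyond `√N` consecutive block indices differ by at most one:
`N/n ≤ N/(n+1) + 1` for `n > Nat.sqrt N`. [folklore] -/
theorem div_le_div_succ_add_one {N n : ℕ} (hn : Nat.sqrt N < n) : N / n ≤ N / (n + 1) + 1 := by
  have h3 : N < n * n := by
    have := Nat.sqrt_lt'.1 hn
    rwa [sq] at this
  have hn0 : 0 < n := by omega
  by_contra hcon
  push Not at hcon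
  set q := N / (n + 1) with hq
  set m := N / n with hm
  have h1 : m * n ≤ N := Nat.div_mul_le_self N n
  have h2 : N < (q + 1) * (n + 1) := by
    have := Nat.lt_div_mul_add (a := N) (b := n + 1) (by omega)
    rw [← hq] at this
    linarith [this]
  have h4 : (q + 2) * n ≤ N := le_trans (Nat.mul_le_mul_right n hcon) h1
  have h5 : n ≤ q := by nlinarith
  have h6 : q * (n + 1) ≤ N := Nat.div_mul_le_self N (n + 1)
  nlinarith

/-- A jump point is the top of its block: if `N/(n+1) < N/n` then `n = N/(N/n)`. [folklore] -/
theorem eq_div_div_of_jump {N n : ℕ} (hn : 1 ≤ n) (hj : N / (n + 1) < N / n) : n = N / (N / n) := by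
  set m := N / n with hm
  have hm1 : 1 ≤ m := lt_of_le_of_lt (Nat.zero_le _) hj
  apply le_antisymm
  · exact (Nat.le_div_iff_mul_le (by omega)).2 (by rw [hm, Nat.mul_comm]; exact Nat.div_mul_le_self N n)
  · have h1 : N < m * (n + 1) := by
      have := (Nat.div_lt_iff_lt_mul (by omega : 0 < n + 1)).1 hj
      linarith
    have h2 : N / m < n + 1 := (Nat.div_lt_iff_lt_mul (by omega)).2 (by rw [Nat.mul_comm] at h1; linarith)
    omega

/-- **The jump sum.** For `F ≥ 0`:
`∑_{M<n<N, N/(n+1)<N/n} F(n) ≤ ∑_{m=2}^{N/(M+1)} F(N/m)` — each jump point `n` is `N/m` for its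
own block index `m = N/n ≥ 2`, injectively. [folklore] -/
theorem sum_jumps_le {F : ℕ → ℝ} (hF : ∀ n, 0 ≤ F n) (M N : ℕ) :
    ∑ n ∈ (Finset.Ico (M + 1) N).filter (fun n ↦ N / (n + 1) < N / n), F n ≤
      ∑ m ∈ Finset.Icc 2 (N / (M + 1)), F (N / m) := by
  set A := (Finset.Ico (M + 1) N).filter (fun n ↦ N / (n + 1) < N / n) with hA
  have hmem : ∀ n ∈ A, M + 1 ≤ n ∧ n < N ∧ N / (n + 1) < N / n := by
    intro n hn
    simp only [hA, Finset.mem_filter, Finset.mem_Ico] at hn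
    exact ⟨hn.1.1, hn.1.2, hn.2⟩
  have hinj : Set.InjOn (fun n ↦ N / n) A := by
    intro n hn n' hn' h
    have h1 := eq_div_div_of_jump (N := N) (n := n) (by have := (hmem n hn).1; omega) (hmem n hn).2.2
    have h2 := eq_div_div_of_jump (N := N) (n := n') (by have := (hmem n' hn').1; omega) (hmem n' hn').2.2
    simp only at h
    rw [h1, h2, h]
  have hsub : A.image (fun n ↦ N / n) ⊆ Finset.Icc 2 (N / (M + 1)) := by
    intro m hm
    obtain ⟨n, hn, rfl⟩ := Finset.mem_image.1 hm
    obtain ⟨h1, h2, h3⟩ := hmem n hn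
    refine Finset.mem_Icc.2 ⟨?_, Nat.div_le_div_left (by omega) (by omega)⟩
    have : 1 ≤ N / (n + 1) := (Nat.one_le_div_iff (by omega)).2 (by omega)
    omega
  have heq : ∑ n ∈ A, F n = ∑ m ∈ A.image (fun n ↦ N / n), F (N / m) := by
    rw [Finset.sum_image hinj]
    refine Finset.sum_congr rfl fun n hn ↦ ?_
    rw [← eq_div_div_of_jump (by have := (hmem n hn).1; omega) (hmem n hn).2.2]
  rw [heq]
  exact Finset.sum_le_sum_of_subset_of_nonneg hsub fun m _ _ ↦ hF _

/-- The size of a jump of `S`: for `n > √N`, `‖S(N/n) − S(N/(n+1))‖ ≤ 𝟙[jump]/(N/n)`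
(`Re s = 1`). [folklore] -/
theorem norm_powSum_div_sub_le {s : ℂ} (hs : s.re = 1) {N n : ℕ} (hn : Nat.sqrt N < n) :
    ‖powSum s (N / (n + 1)) - powSum s (N / n)‖ ≤
      (if N / (n + 1) < N / n then 1 else 0) / ((N / n : ℕ) : ℝ) := by
  have hle : N / (n + 1) ≤ N / n := Nat.div_le_div_left (by omega) (by omega)
  have hle1 := div_le_div_succ_add_one hn
  split_ifs with hj
  · have heq : N / n = N / (n + 1) + 1 := by omega
    rw [heq, powSum_succ, norm_sub_rev, add_sub_cancel_left]
    have hpos : (0 : ℝ) < ((N / (n + 1) + 1 : ℕ) : ℝ) := by positivity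
    rw [norm_npow_of_re_eq_one hs hpos, one_div]
  · have heq : N / (n + 1) = N / n := by omega
    rw [heq, sub_self, norm_zero, zero_div]

/-! ## The substitution `t = e^{uL}` -/

/-- **Change of variables `t = e^{uL}`** (any `g`; both sides are junk together when `g` is not
integrable, by Mathlib's `integral_Icc_deriv_smul_of_deriv_nonneg`):
`∫_{e^{aL}}^{e^{bL}} g(t) dt = ∫_a^b L e^{uL} g(e^{uL}) du` (`L > 0`, `a ≤ b`). [folklore] -/
theorem integral_comp_exp_mul (g : ℝ → ℂ) {L a b : ℝ} (hL : 0 < L) (hab : a ≤ b) :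
    ∫ t in (Real.exp (a * L))..(Real.exp (b * L)), g t =
      ∫ u in a..b, ((L * Real.exp (u * L) : ℝ) : ℂ) * g (Real.exp (u * L)) := by
  set f : ℝ → ℝ := fun u ↦ Real.exp (u * L) with hf
  set f' : ℝ → ℝ := fun u ↦ L * Real.exp (u * L) with hf'
  have hderiv : ∀ x, HasDerivAt f (f' x) x := by
    intro x
    have h1 : HasDerivAt (fun u : ℝ ↦ u * L) L x := by simpa using (hasDerivAt_id x).mul_const L
    have h2 := h1.exp
    simp only [hf, hf']
    convert h2 using 1
    ring
  have hcont : ContinuousOn f (Icc a b) := fun x _ ↦ (hderiv x).continuousAt.continuousWithinAt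
  have hpos : ∀ x ∈ Ioo a b, 0 ≤ f' x := fun x _ ↦ by positivity
  have hmain := MeasureTheory.integral_Icc_deriv_smul_of_deriv_nonneg (g := g) hcont
    (fun x _ ↦ hderiv x) hpos hab
  have hexp : Real.exp (a * L) ≤ Real.exp (b * L) :=
    Real.exp_le_exp.2 (mul_le_mul_of_nonneg_right hab hL.le)
  rw [intervalIntegral.integral_of_le hexp, intervalIntegral.integral_of_le hab,
    ← MeasureTheory.integral_Icc_eq_integral_Ioc, ← MeasureTheory.integral_Icc_eq_integral_Ioc,
    ← hmain]
  refine setIntegral_congr_fun measurableSet_Icc fun u _ ↦ ?_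
  simp only [hf', hf, Complex.real_smul]

/-- Integrability transfers along the substitution: if `g` is integrable on `[e^{aL}, e^{bL}]`
then `u ↦ L e^{uL} g(e^{uL})` is interval integrable on `[a, b]`. [folklore] -/
theorem intervalIntegrable_comp_exp_mul {g : ℝ → ℂ} {L a b : ℝ} (hL : 0 < L) (hab : a ≤ b)
    (hg : IntegrableOn g (Icc (Real.exp (a * L)) (Real.exp (b * L)))) :
    IntervalIntegrable (fun u ↦ ((L * Real.exp (u * L) : ℝ) : ℂ) * g (Real.exp (u * L))) volume a b := by
  set f : ℝ → ℝ := fun u ↦ Real.exp (u * L) with hf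
  set f' : ℝ → ℝ := fun u ↦ L * Real.exp (u * L) with hf'
  have hderiv : ∀ x, HasDerivAt f (f' x) x := by
    intro x
    have h1 : HasDerivAt (fun u : ℝ ↦ u * L) L x := by simpa using (hasDerivAt_id x).mul_const L
    have h2 := h1.exp
    simp only [hf, hf']
    convert h2 using 1
    ring
  have hcont : ContinuousOn f (Icc a b) := fun x _ ↦ (hderiv x).continuousAt.continuousWithinAt
  have hpos : ∀ x ∈ Ioo a b, 0 ≤ f' x := fun x _ ↦ by positivity
  have h := (MeasureTheory.integrableOn_Icc_deriv_smul_iff_of_deriv_nonneg (g := g) hcont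
    (fun x _ ↦ hderiv x) hpos hab).2 hg
  rw [intervalIntegrable_iff_integrableOn_Icc_of_le hab]
  refine h.congr_fun (fun u _ ↦ ?_) measurableSet_Icc
  simp only [hf', hf, Complex.real_smul]

end TuranShift

end Literature.Barriers.RiemannHypothesis
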